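import Summits.Ventures.CertifiedManyBodySolver.Observables.StiffnessThermalSectorGibbsBridge
import HarnessLib

/-!
# ROUTE T-A, torus-limit form: the certificate-reader hook with the word identity required only eventually in `L`

HONEST FRAMING: ladder R1–R4 with certified numbers; no claim on H/H₀. Cell `pub/hubbard-tc` (MO-S3 ORDER → T_c back-end), seat
`hubbard-tc-mod-2` (KT back-end; crux №3 «ROUTE T-A», HOME/hubbard-tc-mod-2/KT-THERMAL-INTERFACE.md §1b). Companion of
`StiffnessThermalSectorGibbsBridge.lean` (p476253/p477166/p478112), whose `…_of_torusLimit_kinetic_bound` asks the word identity (W1)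
`Re⟨ψ, kinOpTT' L t′ ψ⟩/(2L²) = Re torusAvgExpect L Λ W ψ` at EVERY side `L ≥ 1`; the natural word `W` (half the `e₁` f-sum word on the window
`thicken {0} 1`) satisfies it only once the window embeds injectively in the torus (`L ≥ 3`: `torusAvgExpectAt` is `0` otherwise, cf.
`torusAvgExpect_hubbardTTPrime_meanEnergyObs`, stated for `3 ≤ L`). This file asks (W1) only EVENTUALLY in `L` — the form to use.

WHAT THIS IS NOT: not a T_c of any material; not a thermal certificate; not a theorem that the Hubbard model has a Kosterlitz–Thouless transition.

* `ObsThermalStiffnessSeqCeilingAtBeta_of_torusLimit_kinetic_bound_eventually` — (W1) eventually in `L` + (W2) `Re ω(W) ≤ c` for every torus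
  limit `ω` of the canonical sector Gibbs mixtures at `β` ⇒ the single-temperature leaf with constant `c` (tree compactness
  `exists_isTorusLimitOfMixture_sectorGibbs_subseq` + the subsequence mixture hook);
* `ThermalKTDictionaryAt.le_inv_of_torusLimit_kinetic_bound_eventually` (`(π/4)c < 1/β ⇒ Tc ≤ 1/β`) and the `(8, ⅞, 0)`, `β = 4` row form
  `le_quarter_of_torusLimit_kinetic_bound_eventually_four` (`c < 0.3183098 ⇒ Tc ≤ 1/4`).

References: ParamekantiTrivediRanderia1998 eq. (3), §IV; HazraVermaRanderia2019 eqs. (2)–(4); BratteliRobinsonI1987 Thm. 2.3.15; Israel1979 §I.3.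
-/

noncomputable section

namespace Summit.Ventures.CertifiedManyBodySolver.Observables

open Filter Topology Set Real Matrix
open Literature.MathematicalPhysics.QuantumLattice
open Literature.MathematicalPhysics.QuantumFieldTheory
open Literature.MathematicalPhysics.StatisticalMechanics
open Literature.MathematicalPhysics.StatisticalMechanics.KosterlitzThouless
open scoped ComplexConjugate ComplexOrder

/-! ## The hook -/

/-- **Torus-limit kinetic bound ⇒ the single-temperature leaf, word identity eventually in `L`.** As
`ObsThermalStiffnessSeqCeilingAtBeta_of_torusLimit_kinetic_bound`, with (W1) `Re⟨ψ, kinOpTT' L t′ ψ⟩/(2L²) = Re torusAvgExpect L Λ W ψ` required only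
for all sufficiently large sides `L` (e.g. `3 ≤ L`). [cite: ParamekantiTrivediRanderia1998, eq. (3) and §IV] [cite: BratteliRobinsonI1987, Thm. 2.3.15] -/
theorem ObsThermalStiffnessSeqCeilingAtBeta_of_torusLimit_kinetic_bound_eventually {tp U n β : ℝ} (hβ : 0 < β) (hn0 : 0 ≤ n)
    (hn2 : n ≤ 2) {c : ℚ} {Λ : Finset (Literature.Probability.LatticeModels.Site 2)} (W : FermionOp Λ)
    (hW : ∀ᶠ L : ℕ in atTop, ∀ [NeZero L] (ψ : Fock (Orb (FermionTorus 2 L))),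
      (expect (kinOpTT' L tp) ψ).re / (2 * (L : ℝ) ^ 2) = (torusAvgExpect L Λ W ψ).re)
    (hcert : ∀ (ω : InfVolFermionState 2) (Ls : ℕ → ℕ), Tendsto Ls atTop atTop →
      ω.IsTorusLimitOfMixture (sectorGibbsCount n) (fun L => sectorGibbsWeightTT' β 1 tp U n L)
        (fun L => sectorGibbsVectorTT' 1 tp U n L) Ls → (ω.expect Λ W).re ≤ ((c : ℚ) : ℝ)) :
    ObsThermalStiffnessSeqCeilingAtBeta tp U n β c := by
  refine ObsThermalStiffnessSeqCeilingAtBeta_of_sectorGibbsMixture_kinetic_subseq_add hβ fun Ls hLs => ?_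
  obtain ⟨φ, hφ, ω, hω⟩ := exists_isTorusLimitOfMixture_sectorGibbs_subseq 1 tp U hn0 hn2 β hLs
  refine ⟨φ, hφ, fun ε hε => ?_⟩
  have hLφ : Tendsto (Ls ∘ φ) atTop atTop := hLs.comp hφ.tendsto_atTop
  have hωc : (ω.expect Λ W).re ≤ ((c : ℚ) : ℝ) := hcert ω (Ls ∘ φ) hLφ hω
  have hlim : Tendsto (fun j => ∑ i, (sectorGibbsWeightTT' β 1 tp U n (Ls (φ j)) i : ℂ) *
      torusAvgExpect (Ls (φ j)) Λ W (sectorGibbsVectorTT' 1 tp U n (Ls (φ j)) i)) atTop (𝓝 (ω.expect Λ W)) := hω Λ W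
  have hev : ∀ᶠ j in atTop, (∑ i, (sectorGibbsWeightTT' β 1 tp U n (Ls (φ j)) i : ℂ) *
      torusAvgExpect (Ls (φ j)) Λ W (sectorGibbsVectorTT' 1 tp U n (Ls (φ j)) i)).re < ((c : ℚ) : ℝ) + ε :=
    (tendsto_order.1 ((Complex.continuous_re.tendsto _).comp hlim)).2 _ (by linarith)
  have hWφ : ∀ᶠ j in atTop, ∀ [NeZero (Ls (φ j))] (ψ : Fock (Orb (FermionTorus 2 (Ls (φ j))))),
      (expect (kinOpTT' (Ls (φ j)) tp) ψ).re / (2 * ((Ls (φ j) : ℕ) : ℝ) ^ 2) =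
        (torusAvgExpect (Ls (φ j)) Λ W ψ).re := hLφ.eventually hW
  filter_upwards [hev, hWφ] with j hj hWj
  intro hL0
  have hsum : (∑ i, sectorGibbsWeightTT' β 1 tp U n (Ls (φ j)) i *
        (expect (kinOpTT' (Ls (φ j)) tp) (sectorGibbsVectorTT' 1 tp U n (Ls (φ j)) i)).re) /
        (2 * ((Ls (φ j) : ℕ) : ℝ) ^ 2) =
      ∑ i, sectorGibbsWeightTT' β 1 tp U n (Ls (φ j)) i *
        (torusAvgExpect (Ls (φ j)) Λ W (sectorGibbsVectorTT' 1 tp U n (Ls (φ j)) i)).re := by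
    rw [Finset.sum_div]
    refine Finset.sum_congr rfl fun i _ => ?_
    rw [mul_div_assoc, @hWj hL0]
  have hre : (∑ i, (sectorGibbsWeightTT' β 1 tp U n (Ls (φ j)) i : ℂ) *
        torusAvgExpect (Ls (φ j)) Λ W (sectorGibbsVectorTT' 1 tp U n (Ls (φ j)) i)).re =
      ∑ i, sectorGibbsWeightTT' β 1 tp U n (Ls (φ j)) i *
        (torusAvgExpect (Ls (φ j)) Λ W (sectorGibbsVectorTT' 1 tp U n (Ls (φ j)) i)).re := by
    rw [Complex.re_sum]
    refine Finset.sum_congr rfl fun i _ => ?_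
    rw [Complex.re_ofReal_mul]
  rw [hsum, ← hre]
  exact hj.le

namespace ThermalKTDictionaryAt

variable {tp U n : ℝ} {ρe : ℝ → ℝ} {Tc : ℝ}

/-- **ROUTE T-A, torus-limit form, word identity eventually in `L`** ⇒ `Tc ≤ 1/β` under `(π/4)c < 1/β`. Monotonicity-free.
[cite: HazraVermaRanderia2019, eqs. (2)–(4)] -/
theorem le_inv_of_torusLimit_kinetic_bound_eventually (h : ThermalKTDictionaryAt tp U n ρe Tc) {β : ℝ} (hβ : 0 < β) (hn0 : 0 ≤ n)
    (hn2 : n ≤ 2) {c : ℚ} {Λ : Finset (Literature.Probability.LatticeModels.Site 2)} (W : FermionOp Λ)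
    (hW : ∀ᶠ L : ℕ in atTop, ∀ [NeZero L] (ψ : Fock (Orb (FermionTorus 2 L))),
      (expect (kinOpTT' L tp) ψ).re / (2 * (L : ℝ) ^ 2) = (torusAvgExpect L Λ W ψ).re)
    (hcert : ∀ (ω : InfVolFermionState 2) (Ls : ℕ → ℕ), Tendsto Ls atTop atTop →
      ω.IsTorusLimitOfMixture (sectorGibbsCount n) (fun L => sectorGibbsWeightTT' β 1 tp U n L)
        (fun L => sectorGibbsVectorTT' 1 tp U n L) Ls → (ω.expect Λ W).re ≤ ((c : ℚ) : ℝ))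
    (hlt : π / 4 * ((c : ℚ) : ℝ) < 1 / β) : Tc ≤ 1 / β :=
  h.le_inv_of_leafAtBeta hβ (ObsThermalStiffnessSeqCeilingAtBeta_of_torusLimit_kinetic_bound_eventually hβ hn0 hn2 W hW hcert) hlt

/-- **Row form at `(8, ⅞, 0)`, `β = 4`, torus-limit version, word identity eventually in `L`** («T_KT ≤ t/4»): `c < 0.3183098 ⇒ Tc ≤ 1/4`.
[cite: HazraVermaRanderia2019, eqs. (2)–(4)] -/
theorem le_quarter_of_torusLimit_kinetic_bound_eventually_four {ρe : ℝ → ℝ} {Tc : ℝ} (h : ThermalKTDictionaryAt 0 8 (7 / 8) ρe Tc)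
    {c : ℚ} {Λ : Finset (Literature.Probability.LatticeModels.Site 2)} (W : FermionOp Λ)
    (hW : ∀ᶠ L : ℕ in atTop, ∀ [NeZero L] (ψ : Fock (Orb (FermionTorus 2 L))),
      (expect (kinOpTT' L 0) ψ).re / (2 * (L : ℝ) ^ 2) = (torusAvgExpect L Λ W ψ).re)
    (hcert : ∀ (ω : InfVolFermionState 2) (Ls : ℕ → ℕ), Tendsto Ls atTop atTop →
      ω.IsTorusLimitOfMixture (sectorGibbsCount (7 / 8)) (fun L => sectorGibbsWeightTT' 4 1 0 8 (7 / 8) L)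
        (fun L => sectorGibbsVectorTT' 1 0 8 (7 / 8) L) Ls → (ω.expect Λ W).re ≤ ((c : ℚ) : ℝ))
    (hc : ((c : ℚ) : ℝ) < 0.3183098) : Tc ≤ 1 / 4 :=
  h.le_quarter_of_leafAtBeta_four
    (ObsThermalStiffnessSeqCeilingAtBeta_of_torusLimit_kinetic_bound_eventually (by norm_num) (by norm_num) (by norm_num) W hW hcert) hc

end ThermalKTDictionaryAt

/-! ## The mixture-level form: the word need only DOMINATE the kinetic mixture average (symmetric words allowed)

When the certifier's objective is a D₄-symmetric energy-type word (e.g. at `t′ = 0`: `W = −½ ×` the hopping-energy density word, whose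
expectation in any `x ↔ y`-symmetric state is the `e₁` f-sum word per site over 2), the operator identity (W1) fails vector-by-vector but holds —
or holds as an inequality — for the canonical Gibbs MIXTURE averages (D₄-invariance of the sector Gibbs state, `TorusSectorGibbsMixtureSymmetry`).
The form below asks only that: eventually in `L`, the kinetic mixture average `Σ_i p_{L,i} Re⟨ψ_{L,i}, kinOpTT' ψ_{L,i}⟩/(2L²)` is `≤` the real
part of the mixture average of `torusAvgExpect L Λ W`.
-/

/-- **Torus-limit bound on a dominating word ⇒ the single-temperature leaf.** Inputs: (W1≤) eventually in `L`, the canonical Gibbs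
mixture average of `kinOpTT' L t′/(2L²)` is at most the real part of the mixture average of `torusAvgExpect L Λ W` (equality for the `e₁` word;
for symmetric words via the `D₄`-invariance of the sector Gibbs state); (W2) `Re ω(W) ≤ c` for every torus limit `ω` of the sector Gibbs
mixtures at `β`. Conclusion: `ObsThermalStiffnessSeqCeilingAtBeta tp U n β c`.
[cite: ParamekantiTrivediRanderia1998, eq. (3) and §IV] [cite: BratteliRobinsonI1987, Thm. 2.3.15] -/
theorem ObsThermalStiffnessSeqCeilingAtBeta_of_torusLimit_bound_of_mixture_le {tp U n β : ℝ} (hβ : 0 < β) (hn0 : 0 ≤ n)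
    (hn2 : n ≤ 2) {c : ℚ} {Λ : Finset (Literature.Probability.LatticeModels.Site 2)} (W : FermionOp Λ)
    (hW : ∀ᶠ L : ℕ in atTop, ∀ [NeZero L],
      (∑ i, sectorGibbsWeightTT' β 1 tp U n L i *
          (expect (kinOpTT' L tp) (sectorGibbsVectorTT' 1 tp U n L i)).re) / (2 * (L : ℝ) ^ 2) ≤
        (∑ i, (sectorGibbsWeightTT' β 1 tp U n L i : ℂ) * torusAvgExpect L Λ W (sectorGibbsVectorTT' 1 tp U n L i)).re)
    (hcert : ∀ (ω : InfVolFermionState 2) (Ls : ℕ → ℕ), Tendsto Ls atTop atTop →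
      ω.IsTorusLimitOfMixture (sectorGibbsCount n) (fun L => sectorGibbsWeightTT' β 1 tp U n L)
        (fun L => sectorGibbsVectorTT' 1 tp U n L) Ls → (ω.expect Λ W).re ≤ ((c : ℚ) : ℝ)) :
    ObsThermalStiffnessSeqCeilingAtBeta tp U n β c := by
  refine ObsThermalStiffnessSeqCeilingAtBeta_of_sectorGibbsMixture_kinetic_subseq_add hβ fun Ls hLs => ?_
  obtain ⟨φ, hφ, ω, hω⟩ := exists_isTorusLimitOfMixture_sectorGibbs_subseq 1 tp U hn0 hn2 β hLs
  refine ⟨φ, hφ, fun ε hε => ?_⟩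
  have hLφ : Tendsto (Ls ∘ φ) atTop atTop := hLs.comp hφ.tendsto_atTop
  have hωc : (ω.expect Λ W).re ≤ ((c : ℚ) : ℝ) := hcert ω (Ls ∘ φ) hLφ hω
  have hlim : Tendsto (fun j => ∑ i, (sectorGibbsWeightTT' β 1 tp U n (Ls (φ j)) i : ℂ) *
      torusAvgExpect (Ls (φ j)) Λ W (sectorGibbsVectorTT' 1 tp U n (Ls (φ j)) i)) atTop (𝓝 (ω.expect Λ W)) := hω Λ W
  have hev : ∀ᶠ j in atTop, (∑ i, (sectorGibbsWeightTT' β 1 tp U n (Ls (φ j)) i : ℂ) *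
      torusAvgExpect (Ls (φ j)) Λ W (sectorGibbsVectorTT' 1 tp U n (Ls (φ j)) i)).re < ((c : ℚ) : ℝ) + ε :=
    (tendsto_order.1 ((Complex.continuous_re.tendsto _).comp hlim)).2 _ (by linarith)
  have hWφ : ∀ᶠ j in atTop, ∀ [NeZero (Ls (φ j))],
      (∑ i, sectorGibbsWeightTT' β 1 tp U n (Ls (φ j)) i *
          (expect (kinOpTT' (Ls (φ j)) tp) (sectorGibbsVectorTT' 1 tp U n (Ls (φ j)) i)).re) /
          (2 * ((Ls (φ j) : ℕ) : ℝ) ^ 2) ≤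
        (∑ i, (sectorGibbsWeightTT' β 1 tp U n (Ls (φ j)) i : ℂ) *
          torusAvgExpect (Ls (φ j)) Λ W (sectorGibbsVectorTT' 1 tp U n (Ls (φ j)) i)).re := hLφ.eventually hW
  filter_upwards [hev, hWφ] with j hj hWj
  intro hL0
  exact (@hWj hL0).trans hj.le

namespace ThermalKTDictionaryAt

variable {tp U n : ℝ} {ρe : ℝ → ℝ} {Tc : ℝ}

/-- **ROUTE T-A, dominating-word form** ⇒ `Tc ≤ 1/β` under `(π/4)c < 1/β`. Monotonicity-free. [cite: HazraVermaRanderia2019, eqs. (2)–(4)] -/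
theorem le_inv_of_torusLimit_bound_of_mixture_le (h : ThermalKTDictionaryAt tp U n ρe Tc) {β : ℝ} (hβ : 0 < β) (hn0 : 0 ≤ n)
    (hn2 : n ≤ 2) {c : ℚ} {Λ : Finset (Literature.Probability.LatticeModels.Site 2)} (W : FermionOp Λ)
    (hW : ∀ᶠ L : ℕ in atTop, ∀ [NeZero L],
      (∑ i, sectorGibbsWeightTT' β 1 tp U n L i *
          (expect (kinOpTT' L tp) (sectorGibbsVectorTT' 1 tp U n L i)).re) / (2 * (L : ℝ) ^ 2) ≤
        (∑ i, (sectorGibbsWeightTT' β 1 tp U n L i : ℂ) * torusAvgExpect L Λ W (sectorGibbsVectorTT' 1 tp U n L i)).re)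
    (hcert : ∀ (ω : InfVolFermionState 2) (Ls : ℕ → ℕ), Tendsto Ls atTop atTop →
      ω.IsTorusLimitOfMixture (sectorGibbsCount n) (fun L => sectorGibbsWeightTT' β 1 tp U n L)
        (fun L => sectorGibbsVectorTT' 1 tp U n L) Ls → (ω.expect Λ W).re ≤ ((c : ℚ) : ℝ))
    (hlt : π / 4 * ((c : ℚ) : ℝ) < 1 / β) : Tc ≤ 1 / β :=
  h.le_inv_of_leafAtBeta hβ (ObsThermalStiffnessSeqCeilingAtBeta_of_torusLimit_bound_of_mixture_le hβ hn0 hn2 W hW hcert) hlt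

/-- **Row form at `(8, ⅞, 0)`, `β = 4`, dominating-word version** («T_KT ≤ t/4»): `c < 0.3183098 ⇒ Tc ≤ 1/4`.
[cite: HazraVermaRanderia2019, eqs. (2)–(4)] -/
theorem le_quarter_of_torusLimit_bound_of_mixture_le_four {ρe : ℝ → ℝ} {Tc : ℝ} (h : ThermalKTDictionaryAt 0 8 (7 / 8) ρe Tc)
    {c : ℚ} {Λ : Finset (Literature.Probability.LatticeModels.Site 2)} (W : FermionOp Λ)
    (hW : ∀ᶠ L : ℕ in atTop, ∀ [NeZero L],
      (∑ i, sectorGibbsWeightTT' 4 1 0 8 (7 / 8) L i *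
          (expect (kinOpTT' L 0) (sectorGibbsVectorTT' 1 0 8 (7 / 8) L i)).re) / (2 * (L : ℝ) ^ 2) ≤
        (∑ i, (sectorGibbsWeightTT' 4 1 0 8 (7 / 8) L i : ℂ) * torusAvgExpect L Λ W (sectorGibbsVectorTT' 1 0 8 (7 / 8) L i)).re)
    (hcert : ∀ (ω : InfVolFermionState 2) (Ls : ℕ → ℕ), Tendsto Ls atTop atTop →
      ω.IsTorusLimitOfMixture (sectorGibbsCount (7 / 8)) (fun L => sectorGibbsWeightTT' 4 1 0 8 (7 / 8) L)
        (fun L => sectorGibbsVectorTT' 1 0 8 (7 / 8) L) Ls → (ω.expect Λ W).re ≤ ((c : ℚ) : ℝ))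
    (hc : ((c : ℚ) : ℝ) < 0.3183098) : Tc ≤ 1 / 4 :=
  h.le_quarter_of_leafAtBeta_four
    (ObsThermalStiffnessSeqCeilingAtBeta_of_torusLimit_bound_of_mixture_le (by norm_num) (by norm_num) (by norm_num) W hW hcert) hc

end ThermalKTDictionaryAt

end Summit.Ventures.CertifiedManyBodySolver.Observables

end
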